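import Summits.ResolutionOfSingularities.ResolutionOfSingularities.Theorems.FrobeniusClosingSteerToricUnitExitMonomial
import Summits.ResolutionOfSingularities.ResolutionOfSingularities.Theorems.FrobeniusClosingSteerToricVertexExit
import Summits.ResolutionOfSingularities.ResolutionOfSingularities.Theorems.FrobeniusClosingSteerSteeredExit
import Summits.ResolutionOfSingularities.ResolutionOfSingularities.Theorems.FrobeniusClosingSteerRadicandSingularCriterion
import HarnessLib

/-!
# Crux `Steer` (stmt-ResolutionOfSingularities-16345) — K-TX, part 3: THE TORIC TOWER (retyped stub) and K-TX IN CASE A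

OURS (campaign res-hironaka, rung L ★L-G4, slot W4.1; res-D-brk-2 g6 on res-L0-w41-plan-1 RULING 257 (a)(2) — the toric stub
`stub_unit_linear_tower` of res-L0-w41-strat-1's `KTX_skeleton-strat1-g10.lean` f14dbc5d71d79534, RETYPED per RULING 258 (c) / res-D-brk-2
19:00:27Z). Candidates, not facts; NOT a statement of H. Hironaka's manuscript [claim: Hironaka2017, status: under-review]; AI
formalisation, weaker than expert review; `--supports stmt-ResolutionOfSingularities-16345`, counted 0. Definition-free.

## What is proved (any field `K` of characteristic `2`; K-TX's data VERBATIM: a tower `R 0 → ⋯ → R N` of local blowings up w.r.t. `O`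
## with `s i = x·s(i+1) + g`, a regular local stage `R N ⊆ O` dominated by `O` with a regular system of parameters `y`, `dim = n`, and
## `s N² = g² + w·y^M + Σ a_i y^{E_i}`, `w` a unit, `M` with an odd exponent, `v(y^{E_i}) < v(y^M)`)

* **`exists_toric_tower`** (the RETYPED STUB, fully proved): the tower extends by TWO steps — ONE local blowing up `R N → R♯` composed of
  the Perron pair blow-ups and the odd-support reduction of parts 1–2 (decided by `O`), then the division step
  `s N = ỹ·t₁ + g`, `t₁ = (s N − g)/ỹ` (using `(s − g)² = s² − g²` in characteristic 2) — to a REGULAR local stage `R♯ ⊆ O` dominated by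
  `O` where `t₁² = z·W` with `W` a UNIT of `R♯`, `z` the surviving odd letter, `y^M = z·ỹ²`, and the honest case split
  «`z ∈ 𝔪 ∖ 𝔪²` (CASE A) ∨ `z` is a unit of `R♯` (CASE B)». Case B occurs (e.g. `M = (1,1,0,…)` with `v(y₁) = v(y₂)`: the surviving letter
  is `y₂/y₁`); there strat-1's typed output «`z ∈ 𝔪 ∖ 𝔪²`» is not produced.
* `isRegularLocalRing_adjoinRoot_linear_unit` — strat-1's exit at a linear-unit radicand (proof = the skeleton's, by the tree criterion
  `RadicandSingular.not_isRegularLocalRing_adjoinRoot_atMaximalIdeal_iff`).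
* **`concl_of_unit_dominant_monomial_of_value`** — K-TX's conclusion `Concl O A₀ t` (displayed unfolded, as in the skeleton) under the
  ONE extra hypothesis that puts us in CASE A: the value of the vertex `y^M` is not the square of the value of an element of `K`
  (`∀ r, v(y^M) ≠ v(r)²`). The remaining case B (unit survivor; sub-case B1 «residue of `z·W` non-square» is again an immediate exit,
  sub-case B2 needs the fresh-letter cotangent argument) is K-TX part 4.
[cite: NovacoskiSpivakovsky2014, Def. 2.8, Def. 2.11, Lemma 2.9] [cite: DeJong1996, 2.4] [cite: Matsumura1987, Thm. 14.2] [cite: Teissier2014]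
[folklore]
-/

noncomputable section

-- single-problem summit: the doubled namespace component `ResolutionOfSingularities` is forced
set_option linter.dupNamespace false

open scoped BigOperators

namespace Summit.ResolutionOfSingularities.ResolutionOfSingularities.Theorems.SteerToricUnitExit

open Polynomial IsLocalRing
open Literature.AlgebraicGeometry.Resolution
open Summit.ResolutionOfSingularities.ResolutionOfSingularities.Theorems.SwitchingDichotomy
open Summit.ResolutionOfSingularities.ResolutionOfSingularities.Theorems.SteerToricVertexExit

variable {k K : Type} [Field k] [Field K] [Algebra k K]

/-! ## §1 The toric tower (retyped stub) -/

section Tower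

/-- **THE TORIC TOWER** (K-TX's stub, retyped honestly). From K-TX's data the tower of local blowings up extends by two steps (one
composite local blowing up decided by `O`: Perron on the ratios `y^{E_i − M}`, then the odd support of the vertex; then the division step
`s N = ỹ·t₁ + g`) to a regular local stage `R♯ ⊆ O` dominated by `O` with `t₁² = z·W`, `W ∈ (R♯)ˣ`, `y^M = z·ỹ²`, and
`z ∈ 𝔪 ∖ 𝔪²` OR `z ∈ (R♯)ˣ`. OURS. [cite: NovacoskiSpivakovsky2014, Def. 2.11] [cite: DeJong1996, 2.4] [cite: Teissier2014] [folklore] -/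
theorem exists_toric_tower [CharP K 2] (O : ValuationSubring K)
    (R : ℕ → Subring K) (s : ℕ → K) (N : ℕ)
    (hstep : ∀ i < N, IsLocalBlowup O (R i) (R (i + 1)) ∧
      ∃ x g : K, x ∈ R i ∧ g ∈ R i ∧ s i = x * s (i + 1) + g)
    (hreg : IsRegularLocalRing (R N)) (hRO : R N ≤ O.toSubring)
    (hcen : ∀ a : R N, a ∈ maximalIdeal (R N) ↔ O.valuation (a : K) < 1)
    {n m : ℕ} (y : Fin n → R N) (hy : Ideal.span (Set.range y) = maximalIdeal (R N))
    (hn : ringKrullDim (R N) = n)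
    (g w : R N) (hw : IsUnit w) (a : Fin m → R N)
    (M : Fin n → ℕ) (hodd : ∃ j, Odd (M j)) (E : Fin m → Fin n → ℕ)
    (heq : s N ^ 2 = (g : K) ^ 2 + (w : K) * ∏ j, (y j : K) ^ M j +
      ∑ i, (a i : K) * ∏ j, (y j : K) ^ E i j)
    (hdom : ∀ i, O.valuation (∏ j, (y j : K) ^ E i j) < O.valuation (∏ j, (y j : K) ^ M j)) :
    ∃ (R' : ℕ → Subring K) (s' : ℕ → K) (N' : ℕ), R' 0 = R 0 ∧ s' 0 = s 0 ∧
      (∀ i < N', IsLocalBlowup O (R' i) (R' (i + 1)) ∧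
        ∃ x g : K, x ∈ R' i ∧ g ∈ R' i ∧ s' i = x * s' (i + 1) + g) ∧
      ∃ (_ : IsRegularLocalRing (R' N')), R' N' ≤ O.toSubring ∧
        (∀ q : R' N', q ∈ maximalIdeal (R' N') ↔ O.valuation (q : K) < 1) ∧
        ∃ (hsq : s' N' ^ 2 ∈ R' N') (z W : R' N') (r : K),
          (⟨s' N' ^ 2, hsq⟩ : R' N') = z * W ∧ IsUnit W ∧ (∏ j, (y j : K) ^ M j) = (z : K) * r ^ 2 ∧
          ((z ∈ maximalIdeal (R' N') ∧ z ∉ maximalIdeal (R' N') ^ 2) ∨ IsUnit z) := by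
  classical
  have htwo : (2 : K) = 0 := by exact_mod_cast CharP.cast_eq_zero K 2
  -- §1.1 the starting frame and the ratios
  set z₀ : Fin n → K := fun j => (y j : K) with hz₀
  have hF₀ : Frame O (R N) z₀ := frame_of_rsop O (R N) hreg hRO hcen y hy hn
  have hy0 : ∀ j, z₀ j ≠ 0 := hF₀.ne_zero
  set F : Fin m → Fin n → ℤ := fun i j => (E i j : ℤ) - M j with hFdef
  have hP0 : (∏ j, z₀ j ^ M j) ≠ 0 := Finset.prod_ne_zero_iff.mpr fun j _ => pow_ne_zero _ (hy0 j)
  have hratio : ∀ i, (∏ j, z₀ j ^ F i j) = (∏ j, z₀ j ^ E i j) / ∏ j, z₀ j ^ M j := fun i => by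
    rw [eq_div_iff hP0, ← SteerToricVertexExit.prod_zpow_natCast, ← SteerToricVertexExit.prod_zpow_natCast, ← SteerToricConcl.prod_zpow_add z₀ hy0]
    exact Finset.prod_congr rfl fun j _ => by simp [hFdef]
  have hF1 : ∀ i, O.valuation (∏ j, z₀ j ^ F i j) < 1 := fun i => by
    rw [hratio, map_div₀]
    exact (div_lt_one₀ (zero_lt_iff.mpr ((_root_.map_ne_zero _).mpr hP0))).mpr (hdom i)
  -- §1.2 Perron and odd-support reduction, by local blowings up
  obtain ⟨R₁, z₁, T₁, hR₁, hT₁F⟩ := exists_krel_nonneg_family O m (R N) z₀ hF₀ F hF1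
  set p₀ : Fin n → ℤ := fun j => (M j : ℤ) with hp₀
  have hp₀nn : ∀ j, 0 ≤ p₀ j := fun j => by simp [hp₀]
  have hp₀odd : ∃ j, Odd (p₀ j) := by
    obtain ⟨j, hj⟩ := hodd; exact ⟨j, by simpa [hp₀] using (Int.odd_coe_nat _).mpr hj⟩
  obtain ⟨R₂, z₂, T₂, hR₂, ia, ha, heven⟩ :=
    exists_krel_single_odd O _ R₁ z₁ hR₁.2.1 (T₁ p₀) le_rfl (hR₁.2.2.2.2.2 _ hp₀odd)
  have hR : KRel O (R N) z₀ R₂ z₂ (T₂ ∘ T₁) := krel_trans O hR₁ hR₂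
  obtain ⟨hbl, hF₂, hmono, -, hnn, -⟩ := hR
  have hNR₂ : R N ≤ R₂ := hbl.le
  obtain ⟨hreg₂, hR₂O, hR₂loc, hcen₂, hz₂0, hz₂, -⟩ := id hF₂
  set p : Fin n → ℤ := T₂ (T₁ p₀) with hp
  set gv : Fin m → Fin n → ℤ := fun i => T₂ (T₁ (F i)) with hgv
  have hpnn : ∀ j, 0 ≤ p j := hnn _ hp₀nn
  have hgnn : ∀ i j, 0 ≤ gv i j := fun i => hR₂.2.2.2.2.1 _ (hT₁F i)
  have hp_eq : (∏ j, z₂ j ^ p j) = ∏ j, z₀ j ^ M j := by rw [hp, ← SteerToricVertexExit.prod_zpow_natCast]; exact hmono p₀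
  have hg_eq : ∀ i, (∏ j, z₂ j ^ gv i j) = ∏ j, z₀ j ^ F i j := fun i => hmono (F i)
  -- §1.3 `y^M = z_a · ỹ²`
  set q : Fin n → ℤ := fun j => p j / 2 with hq
  have hqnn : ∀ j, 0 ≤ q j := fun j => Int.ediv_nonneg (hpnn j) (by norm_num)
  have hpq : ∀ j, p j = 2 * q j + if j = ia then 1 else 0 := fun j => by
    have hqj : q j = p j / 2 := rfl
    by_cases hja : j = ia
    · subst hja; rw [if_pos rfl, hqj]; have h := Int.odd_iff.mp ha; omega
    · rw [if_neg hja, add_zero, hqj]; have h := Int.even_iff.mp (heven j hja); omega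
  set yt : K := ∏ j, z₂ j ^ q j with hyt
  have hyt0 : yt ≠ 0 := Finset.prod_ne_zero_iff.mpr fun j _ => zpow_ne_zero _ (hz₂0 j)
  have hytR : yt ∈ R₂ := by
    rw [hyt, prod_zpow_eq_prod_pow_toNat z₂ q hqnn]; exact prod_mem fun j _ => pow_mem (hz₂ j) _
  have hP : (∏ j, z₀ j ^ M j) = z₂ ia * yt ^ 2 := by
    rw [← hp_eq, Finset.prod_congr rfl fun j _ => by rw [hpq j], SteerToricConcl.prod_zpow_add z₂ hz₂0,
      SteerToricConcl.prod_zpow_mul z₂ 2 q, prod_zpow_indicator, hyt, mul_comm]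
    norm_cast
  -- §1.4 the unit cofactor `W = w + Σ a_i r_i`
  set rv : Fin m → K := fun i => ∏ j, z₂ j ^ gv i j with hrv
  have hrvR : ∀ i, rv i ∈ R₂ := fun i => by
    show (∏ j, z₂ j ^ gv i j) ∈ R₂
    rw [prod_zpow_eq_prod_pow_toNat z₂ (gv i) (hgnn i)]; exact prod_mem fun j _ => pow_mem (hz₂ j) _
  have hrv1 : ∀ i, O.valuation (rv i) < 1 := fun i => by show O.valuation (∏ j, z₂ j ^ gv i j) < 1; rw [hg_eq]; exact hF1 i
  set Wv : K := (w : K) + ∑ i, (a i : K) * rv i with hWv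
  have hWvR : Wv ∈ R₂ := add_mem (hNR₂ w.2) (sum_mem fun i _ => mul_mem (hNR₂ (a i).2) (hrvR i))
  have hvw : O.valuation (w : K) = 1 := by
    apply le_antisymm ((O.valuation_le_one_iff _).mpr (hRO w.2))
    by_contra hlt
    push Not at hlt
    exact (IsLocalRing.mem_maximalIdeal _).mp ((hcen w).mpr hlt) hw
  have hvW : O.valuation Wv = 1 := by
    rw [hWv, Valuation.map_add_eq_of_lt_left]
    · exact hvw
    · rw [hvw]
      refine Valuation.map_sum_lt _ one_ne_zero fun i _ => ?_
      rw [Valuation.map_mul]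
      calc O.valuation (a i : K) * O.valuation (rv i) ≤ 1 * O.valuation (rv i) :=
            mul_le_mul_left ((O.valuation_le_one_iff _).mpr (hRO (a i).2)) _
        _ < 1 := by rw [one_mul]; exact hrv1 i
  have hWunit : IsUnit (⟨Wv, hWvR⟩ : R₂) := by
    by_contra hnu
    have := (hcen₂ _).mp ((IsLocalRing.mem_maximalIdeal _).mpr hnu)
    exact absurd hvW (ne_of_lt this)
  -- §1.5 the division step `t₁ = (s N − g)/ỹ`, `t₁² = z_a · W`
  set t₁ : K := (s N - g) / yt with ht₁
  have hsum : (∑ i, (a i : K) * ∏ j, z₀ j ^ E i j) = (∏ j, z₀ j ^ M j) * ∑ i, (a i : K) * rv i := by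
    rw [Finset.mul_sum]
    refine Finset.sum_congr rfl fun i _ => ?_
    have e : (∏ j, z₀ j ^ E i j) = (∏ j, z₀ j ^ M j) * rv i := by
      show (∏ j, z₀ j ^ E i j) = (∏ j, z₀ j ^ M j) * ∏ j, z₂ j ^ gv i j
      rw [hg_eq, hratio, mul_div_cancel₀ _ hP0]
    rw [e]; ring
  have hsq_id : (s N - g) ^ 2 = z₂ ia * yt ^ 2 * Wv := by
    have e : (s N - (g : K)) ^ 2 = s N ^ 2 + (g : K) ^ 2 - 2 * (s N * g) := by ring
    rw [e, htwo, zero_mul, sub_zero, heq, hsum, hP, hWv]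
    have e2 : ((g : K)) ^ 2 + ((g : K)) ^ 2 = 2 * (g : K) ^ 2 := by ring
    linear_combination e2 + (0 : K) * htwo + (g : K) ^ 2 * htwo
  have ht₁sq : t₁ ^ 2 = z₂ ia * Wv := by
    rw [ht₁, div_pow, hsq_id]; field_simp
  have ht₁R : t₁ ^ 2 ∈ R₂ := by rw [ht₁sq]; exact mul_mem (hz₂ ia) hWvR
  -- §1.6 the extended tower
  let R' : ℕ → Subring K := fun i => if i ≤ N then R i else R₂
  let s' : ℕ → K := fun i => if i ≤ N then s i else if i = N + 1 then s N else t₁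
  have hR'N2 : R' (N + 2) = R₂ := by simp [R']
  have hs'N2 : s' (N + 2) = t₁ := by simp [s']
  have hblR₂ : IsLocalBlowup O R₂ R₂ :=
    ⟨hR₂O, ∅, by simp, by rw [Finset.coe_empty, Set.union_empty, Subring.closure_eq, hR₂loc]⟩
  refine ⟨R', s', N + 2, by simp [R'], by simp [s'], ?_, ?_⟩
  · intro i hi
    rcases Nat.lt_or_ge i N with hlt | hge
    · obtain ⟨hb, x, g', hx, hg', hs⟩ := hstep i hlt
      have e1 : R' i = R i := by simp [R', hlt.le]
      have e2 : R' (i + 1) = R (i + 1) := by simp [R', Nat.succ_le_of_lt hlt]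
      have e3 : s' i = s i := by simp [s', hlt.le]
      have e4 : s' (i + 1) = s (i + 1) := by simp [s', Nat.succ_le_of_lt hlt]
      rw [e1, e2, e3, e4]
      exact ⟨hb, x, g', hx, hg', hs⟩
    · rcases Nat.lt_or_ge i (N + 1) with hlt1 | hge1
      · have hi' : i = N := by omega
        subst hi'
        have e1 : R' i = R i := by simp [R']
        have e2 : R' (i + 1) = R₂ := by simp [R']
        have e3 : s' i = s i := by simp [s']
        have e4 : s' (i + 1) = s i := by simp [s']
        rw [e1, e2, e3, e4]
        exact ⟨hbl, 1, 0, one_mem _, zero_mem _, by ring⟩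
      · have hi' : i = N + 1 := by omega
        subst hi'
        have e1 : R' (N + 1) = R₂ := by simp [R']
        have e2 : R' (N + 1 + 1) = R₂ := by simp [R']
        have e3 : s' (N + 1) = s N := by simp [s']
        have e4 : s' (N + 1 + 1) = t₁ := by simp [s']
        rw [e1, e2, e3, e4]
        refine ⟨hblR₂, yt, g, hytR, hNR₂ g.2, ?_⟩
        rw [ht₁, mul_div_cancel₀ _ hyt0]; ring
  · rw [hR'N2]
    refine ⟨hreg₂, hR₂O, hcen₂, ?_⟩
    rw [hs'N2]
    refine ⟨ht₁R, ⟨z₂ ia, hz₂ ia⟩, ⟨Wv, hWvR⟩, yt, Subtype.ext (by simpa using ht₁sq), hWunit, hP, ?_⟩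
    by_cases hva : O.valuation (z₂ ia) < 1
    · left
      obtain ⟨_, hzia, hnsq⟩ := hF₂.not_mem_sq ia hva
      exact ⟨(hcen₂ _).mpr hva, hnsq⟩
    · right
      by_contra hnu
      exact hva ((hcen₂ _).mp ((IsLocalRing.mem_maximalIdeal _).mpr hnu))

end Tower

/-! ## §2 The exit at a linear-unit radicand (strat-1's lemma) -/

section Exit

/-- **The exit at a LINEAR-UNIT radicand** (res-L0-w41-strat-1's `isRegularLocalRing_adjoinRoot_linear_unit`, K-TX skeleton
f14dbc5d71d79534, proof verbatim): `z ∈ 𝔪 ∖ 𝔪²`, `W` a unit ⇒ the torsor germ `R_𝔪[T]/(T² − z·W)` is regular, by the tree criterion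
`RadicandSingular.not_isRegularLocalRing_adjoinRoot_atMaximalIdeal_iff`. [cite: Matsumura1987, Thm. 14.2] -/
theorem isRegularLocalRing_adjoinRoot_linear_unit {S : Type} [CommRing S] [IsRegularLocalRing S] [CharP S 2]
    (z W : S) (hz : z ∈ maximalIdeal S) (hz2 : z ∉ maximalIdeal S ^ 2) (hW : IsUnit W) :
    IsRegularLocalRing (AdjoinRoot (X ^ 2 -
      C (algebraMap S (Localization.AtPrime (maximalIdeal S)) (z * W)) : (Localization.AtPrime (maximalIdeal S))[X])) := by
  haveI : Fact (2 : ℕ).Prime := ⟨Nat.prime_two⟩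
  by_contra h
  obtain ⟨c, hc⟩ := (RadicandSingular.not_isRegularLocalRing_adjoinRoot_atMaximalIdeal_iff (S := S) 2 (z * W)).mp h
  by_cases hcm : c ∈ maximalIdeal S
  · have hc2 : c ^ 2 ∈ maximalIdeal S ^ 2 := Ideal.pow_mem_pow hcm 2
    have hzW : z * W ∈ maximalIdeal S ^ 2 := by
      have := Ideal.add_mem _ hc hc2
      simpa using this
    obtain ⟨u, rfl⟩ := hW
    apply hz2
    have : z * (u : S) * (↑u⁻¹ : S) ∈ maximalIdeal S ^ 2 := Ideal.mul_mem_right _ _ hzW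
    simpa [mul_assoc] using this
  · have hcu : IsUnit c := of_not_not fun hnu => hcm ((IsLocalRing.mem_maximalIdeal c).mpr hnu)
    have hmem : z * W - c ^ 2 ∈ maximalIdeal S := Ideal.pow_le_self two_ne_zero hc
    have hzWm : z * W ∈ maximalIdeal S := Ideal.mul_mem_right _ _ hz
    have hc2m : c ^ 2 ∈ maximalIdeal S := by
      have := Ideal.sub_mem _ hzWm hmem
      simpa using this
    exact (IsLocalRing.mem_maximalIdeal _).mp hc2m (hcu.pow 2)

end Exit

/-! ## §3 K-TX in case A -/

section KTX

/-- **K-TX in CASE A** (res-L0-w41-strat-1's `concl_of_unit_dominant_monomial`, K-TX skeleton f14dbc5d71d79534, with ONE extra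
hypothesis `hval` that forces case A of `exists_toric_tower`): unit-dominant monomial with an odd exponent at a member reached by local
blowings up, whose VALUE IS NOT THE SQUARE OF A VALUE OF `K`, ⇒ `Concl O A₀ t` (displayed unfolded). PROVED: toric tower (§1) — in case A
the radicand `z·W` has `z ∈ 𝔪 ∖ 𝔪²` (a unit survivor `z` would give `v(y^M) = v(ỹ)²`) — exit (§2) — `SteeredExit.concl_of_exit`. OURS.
[cite: NovacoskiSpivakovsky2014, Def. 2.8, Lemma 2.5, Lemma 2.9] [cite: Matsumura1987, Thm. 14.2, Thm. 19.3] [folklore] -/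
theorem concl_of_unit_dominant_monomial_of_value [CharP K 2] (O : ValuationSubring K) (A₀ : Subalgebra k K)
    (h₀ : A₀.toSubring ≤ O.toSubring) (t : K) (hfg : A₀.FG)
    (hfr : IsFractionRing (Algebra.adjoin k (insert t (A₀ : Set K))) K)
    (R : ℕ → Subring K) (hR0 : R 0 = locAtCentre A₀.toSubring O)
    (s : ℕ → K) (N : ℕ) (hs0 : s 0 = t)
    (hstep : ∀ i < N, IsLocalBlowup O (R i) (R (i + 1)) ∧
      ∃ x g : K, x ∈ R i ∧ g ∈ R i ∧ s i = x * s (i + 1) + g)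
    (hreg : IsRegularLocalRing (R N))
    (hRO : R N ≤ O.toSubring) (hcen : ∀ a : R N, a ∈ maximalIdeal (R N) ↔ O.valuation (a : K) < 1)
    {n m : ℕ} (y : Fin n → R N) (hy : Ideal.span (Set.range y) = maximalIdeal (R N))
    (hn : ringKrullDim (R N) = n)
    (g w : R N) (hw : IsUnit w) (a : Fin m → R N)
    (M : Fin n → ℕ) (hodd : ∃ j, Odd (M j)) (E : Fin m → Fin n → ℕ)
    (heq : s N ^ 2 = (g : K) ^ 2 + (w : K) * ∏ j, (y j : K) ^ M j +
      ∑ i, (a i : K) * ∏ j, (y j : K) ^ E i j)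
    (hdom : ∀ i, O.valuation (∏ j, (y j : K) ^ E i j) < O.valuation (∏ j, (y j : K) ^ M j))
    (hval : ∀ r : K, O.valuation (∏ j, (y j : K) ^ M j) ≠ O.valuation r ^ 2) :
    ∃ (A : Subalgebra k K) (h : A.toSubring ≤ O.toSubring), A₀ ≤ A ∧ t ∈ A ∧ A.FG ∧
      IsFractionRing A K ∧ IsRegularLocalRing (Localization.AtPrime
        (Ideal.comap (Subring.inclusion h) (IsLocalRing.maximalIdeal O))) := by
  obtain ⟨R', s', N', hR0', hs0', hstep', hreg', hR'O, hcen', hsq, z, W, r, hzW, hW, hPM, hcase⟩ :=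
    exists_toric_tower O R s N hstep hreg hRO hcen y hy hn g w hw a M hodd E heq hdom
  haveI := hreg'
  haveI : CharP (R' N') 2 := CharP.subring' K 2 (R' N')
  -- case B is excluded by `hval`: a unit survivor `z` would give `v(y^M) = v(r)²`
  have hA : z ∈ maximalIdeal (R' N') ∧ z ∉ maximalIdeal (R' N') ^ 2 := by
    rcases hcase with hA | hzu
    · exact hA
    · exfalso
      have hvz : O.valuation (z : K) = 1 := by
        apply le_antisymm ((O.valuation_le_one_iff _).mpr (hR'O z.2))
        by_contra hlt
        push Not at hlt
        exact (IsLocalRing.mem_maximalIdeal _).mp ((hcen' z).mpr hlt) hzu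
      apply hval r
      rw [hPM, Valuation.map_mul, hvz, one_mul, Valuation.map_pow]
  have hregT : IsRegularLocalRing (AdjoinRoot (X ^ 2 -
      C (algebraMap (R' N') (Localization.AtPrime (maximalIdeal (R' N'))) ⟨s' N' ^ 2, hsq⟩))) := by
    rw [hzW]
    exact isRegularLocalRing_adjoinRoot_linear_unit z W hA.1 hA.2 hW
  exact SteeredExit.concl_of_exit O A₀ h₀ t hfg hfr two_pos R' (hR0'.trans hR0) s' N' (hs0'.trans hs0) hstep'
    inferInstance hsq hregT

end KTX

end Summit.ResolutionOfSingularities.ResolutionOfSingularities.Theorems.SteerToricUnitExit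

end
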